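import Summits.HodgeConjecture.CorCM.MultiFieldWeilSimpleFamiliesStandalone
import Summits.HodgeConjecture.CorCM.MultiFieldWeilForeignBlocks
import HarnessLib

/-!
# MULTI-FIELD WEIL ENGINE — SIMPLE CM THREEFOLDS FROM SEVERAL IMAGINARY QUADRATIC FIELDS: blocks of simple CM threefolds, each block a cubic tower over its own
# imaginary quadratic field, the blocks pairwise foreign — the Hodge conjecture for every product of copies, given ONLY Markman's fourfold theorem

Cell `pub-hodgecm2` (COR-CM), seat b30 gen 33 (2026-08-24); count-neutral own lane MULTI-FIELD WEIL ENGINE (stem `MultiFieldWeil*`).  The composite of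
`CorCM/MultiFieldWeilSimpleFamiliesStandalone.lean` (ONE imaginary quadratic field: simple CM threefolds over a cubic tower, no curve, no type hypothesis) and
`CorCM/MultiFieldWeilForeignBlocks.lean` (gen 31, G10: the Hodge conjecture glues along any number of pairwise foreign blocks — an unconditional transfer).  Theorems
only; no definition, no named fact, no `sorry`.  HONEST FRAMING: conditional on the displayed Markman fourfold binder only; `HC_CM` is NOT proved and not asserted.

THE STATEMENT (**`hodgeConjectureFor_prod_of_simpleThreefolds_blocks_of_conj_apply_eq`**).  A finite nonempty family `A_i ⊨ (K_i; Φ_i)` (`i ∈ I`) of SIMPLE CM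
abelian threefolds (sextic CM fields `K_i`, realisations read on `H¹`, nothing assumed on the types), a block map `b : I → β`, and for every block `c`: an imaginary
quadratic field `k_c` with a chosen complex embedding `τ_c`, an enumeration `is c : Fin (r c) → I` of the block, embeddings `im c m : k_c → K_{is c m}` and
`s c m ⊃ τ_c` of the block's fields such that NO `τ_c`-embedding of `K_{is c m}` takes its values in `ℚ(τ_c k_c) · s_{c,0}(K) ⋯ s_{c,m−1}(K)` (a cubic tower over
`k_c`).  If for every block `c` complex conjugation fixes the intersection of the compositum of the Galois closures of the fields of block `c` with the compositum of
the Galois closures of all the other fields (the blocks are FOREIGN: e.g. the two composita meet in `ℚ`, or in a field of odd degree), then the Hodge conjecture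
holds for EVERY product of copies `⨁_j A_{π j}` of the whole family, GIVEN ONLY `Markman2025_weilClasses_algebraic_abelianFourfold`.  Inside a block this is the
standalone cubic-tower theorem (`hodgeConjectureFor_biproduct_simpleThreefolds_of_cubicTower`, re-indexed along the enumeration: `hodgeConjectureFor_prod_block_…`);
across blocks it is G10.  Variants: `…_of_inf_eq_bot` (composita meeting in `ℚ`), `…_of_odd_finrank_inf` (meeting in a field of odd degree), dominated form.

WHAT IS NOT COVERED (honest).  Blocks whose closure-composita meet in a CM field (e.g. two blocks over `k ≠ k'` whose fields share a cubic subfield AND whose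
closures both contain `k k'`); inside a block, fields off the tower (`C₃ × C₃` composita).  Curves: the CM elliptic curves `E_c` of the `k_c` are not members of the
family here; the one-block engine form with the curve is `hodgeConjectureFor_biproduct_comp_of_simpleThreefolds_of_cubicTower` (`CorCM/MultiFieldWeilSimpleFamilies.lean`).

[cite: Markman2025SurveySecant, Thm. 1.2] [cite: Pohlmann1968, Thm 1] [cite: Milne2020HodgeClassesAV, 1.2 (a) and Thm. 1] [cite: Lang2002, VI §1 Thm. 1.1, Thm. 1.14 and V §2 Thm. 2.8]
[cite: Shimura1998, §6.2 Thm. 3, §8.2 Prop. 26, §8.4, §18.2 Lemma (i)]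

## References
* [Markman2025SurveySecant] E. Markman, arXiv:2509.23403, Thm. 1.2.  [Pohlmann1968] H. Pohlmann, Ann. of Math. 88 (1968), Thm 1.  [Milne2020HodgeClassesAV]
  J. S. Milne, *Hodge classes on abelian varieties* (notes, 2020), §1.  [Lang2002] S. Lang, *Algebra*, GTM 211, V §2, VI §1.  [Shimura1998] G. Shimura, *Abelian
  varieties with complex multiplication and modular functions*, §6.2, §8.2, §8.4, §18.2.
-/

noncomputable section

open CategoryTheory CategoryTheory.Limits NumberField IntermediateField

namespace Summit.HodgeConjecture.CorCM.MultiFieldWeil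

open Finset
open Literature.AlgebraicGeometry Literature.AlgebraicGeometry.Motives Literature.AlgebraicGeometry.HodgeTheory
open Literature.AlgebraicGeometry.ComplexMultiplication (IsCMTypeRealisation)
open Literature.AlgebraicTopology.SingularHomology
open Literature.NumberTheory.ComplexMultiplication

open scoped Classical

section Blocks

variable {I : Type} {K : I → Type} [∀ i, Field (K i)] [∀ i, NumberField (K i)] [∀ i, IsCMField (K i)]
  {Φ : ∀ i, CMType (K i)} {A : I → AbelianVariety ℂ} {ι : ∀ i, 𝓞 (K i) →+* End (A i)} {θ : ∀ i, K i →+* Module.End ℂ (complexBetti (A i).X 1)}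
  {β : Type} {kq : β → Type} [fk : ∀ c, Field (kq c)] [nk : ∀ c, NumberField (kq c)] [ck : ∀ c, IsCMField (kq c)] {r : β → ℕ}

/-! ## §1 Inside one block: the standalone cubic-tower theorem, re-indexed along the block's enumeration -/

/-- **The Hodge conjecture inside a block.**  Simple CM threefolds `A_i ⊨ (K_i; Φ_i)`; block `c` with its imaginary quadratic field `k_c = kq c`, embedding `τ_c`,
enumeration `is c : Fin (r c) → I` covering the block, `im c m : k_c → K_{is c m}`, embeddings `s c m ⊃ τ_c` in a cubic tower.  Then every product of copies
`⨁_l A_{ρ l}` with all `ρ l` in block `c` satisfies the Hodge conjecture, GIVEN ONLY Markman's fourfold theorem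
(`hodgeConjectureFor_biproduct_simpleThreefolds_of_cubicTower` for the family `m ↦ A_{is c m}`, and `ρ` factors through the enumeration). [cite: Markman2025SurveySecant, Thm. 1.2]
[cite: Shimura1998, §6.2 Thm. 3, §8.2 Prop. 26, §8.4, §18.2 Lemma (i)] [cite: Lang2002, VI §1 Thm. 1.1 and V §2 Thm. 2.8] -/
theorem hodgeConjectureFor_prod_block_of_simpleThreefolds_of_cubicTower (hW4 : Markman2025_weilClasses_algebraic_abelianFourfold)
    (hA : ∀ i, IsCMTypeRealisation (Φ i) (A i) (ι i) (θ i)) (hS : ∀ i, (A i).IsSimple) (h6 : ∀ i, Module.finrank ℚ (K i) = 6) (b : I → β)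
    (is : ∀ c, Fin (r c) → I) (hcov : ∀ c i, b i = c → ∃ m : Fin (r c), is c m = i) (h2 : ∀ c, Module.finrank ℚ (kq c) = 2)
    (im : ∀ c m, kq c →+* K (is c m)) (τ : ∀ c, kq c →+* ℂ) (s : ∀ c m, K (is c m) →+* ℂ) (hs : ∀ c m, (s c m).comp (im c m) = τ c)
    (htower : ∀ c (m : Fin (r c)) (φ : K (is c m) →+* ℂ), φ.comp (im c m) = τ c →
      ¬ Set.range φ ⊆ (↑(adjoin ℚ (Set.range (τ c)) ⊔ adjoin ℚ (⋃ j : {j : Fin (r c) // j < m}, Set.range (s c j.1))) : Set ℂ))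
    (c : β) (M : ℕ) (ρ : Fin M → I) (hρ : ∀ l, b (ρ l) = c) :
    HodgeConjectureFor (⨁ fun l => A (ρ l)).dim (⨁ fun l => A (ρ l)).X := by
  choose κ hκ using fun l => hcov c (ρ l) (hρ l)
  have h := hodgeConjectureFor_biproduct_simpleThreefolds_of_cubicTower (K := fun m => K (is c m)) (T := fun m => A (is c m))
    (Φ := fun m => Φ (is c m)) (ι := fun m => ι (is c m)) (θ := fun m => θ (is c m)) hW4 κ (h2 c) (fun m => h6 (is c m)) (im c)
    (fun m => hA (is c m)) (fun m => hS (is c m)) (τ c) (s c) (hs c) (htower c)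
  have hfun : (fun l => (fun m => A (is c m)) (κ l)) = fun l => A (ρ l) := funext fun l => by simp only [hκ l]
  rw [hfun] at h
  exact h

/-! ## §2 Across blocks: gluing along pairwise foreign blocks (G10) -/

/-- **SIMPLE CM THREEFOLDS FROM SEVERAL IMAGINARY QUADRATIC FIELDS — given ONLY Markman's fourfold theorem.**  A finite nonempty family `A_i ⊨ (K_i; Φ_i)` of SIMPLE
CM abelian threefolds (sextic `K_i`, nothing assumed on the types), a block map `b : I → β`; every block `c` carries an imaginary quadratic field `k_c`, an embedding
`τ_c`, an enumeration `is c` of its members, embeddings `im c m : k_c → K_{is c m}` and `s c m ⊃ τ_c` forming a CUBIC TOWER over `k_c` (no `τ_c`-embedding of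
`K_{is c m}` into `ℚ(τ_c k_c) · s_{c,0}(K) ⋯ s_{c,m−1}(K)`); and the blocks are FOREIGN: for every `c`, complex conjugation fixes `L_c ∩ L_{≠c}`, `L_c` the
compositum of the Galois closures `normalClosure ℚ K_i ℂ` over the block, `L_{≠c}` over its complement.  Then the Hodge conjecture holds for EVERY product of copies
`⨁_j A_{π j}` — every `∏_i A_i^{a_i}` — GIVEN ONLY `Markman2025_weilClasses_algebraic_abelianFourfold`.  `HC_CM` is NOT asserted. [cite: Markman2025SurveySecant, Thm. 1.2]
[cite: Pohlmann1968, Thm 1] [cite: Milne2020HodgeClassesAV, 1.2 (a) and Thm. 1] [cite: Lang2002, VI §1 Thm. 1.14 and V §2 Thm. 2.8] -/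
theorem hodgeConjectureFor_prod_of_simpleThreefolds_blocks_of_conj_apply_eq [Finite I] [Nonempty I]
    (hW4 : Markman2025_weilClasses_algebraic_abelianFourfold) (hA : ∀ i, IsCMTypeRealisation (Φ i) (A i) (ι i) (θ i)) (hS : ∀ i, (A i).IsSimple)
    (h6 : ∀ i, Module.finrank ℚ (K i) = 6) (b : I → β) (is : ∀ c, Fin (r c) → I) (hcov : ∀ c i, b i = c → ∃ m : Fin (r c), is c m = i)
    (h2 : ∀ c, Module.finrank ℚ (kq c) = 2) (im : ∀ c m, kq c →+* K (is c m)) (τ : ∀ c, kq c →+* ℂ) (s : ∀ c m, K (is c m) →+* ℂ)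
    (hs : ∀ c m, (s c m).comp (im c m) = τ c)
    (htower : ∀ c (m : Fin (r c)) (φ : K (is c m) →+* ℂ), φ.comp (im c m) = τ c →
      ¬ Set.range φ ⊆ (↑(adjoin ℚ (Set.range (τ c)) ⊔ adjoin ℚ (⋃ j : {j : Fin (r c) // j < m}, Set.range (s c j.1))) : Set ℂ))
    (hreal : ∀ (c : β) (x : ℂ), x ∈ (⨆ i : {i : I // b i = c}, normalClosure ℚ (K i.1) ℂ) → x ∈ (⨆ i : {i : I // b i ≠ c}, normalClosure ℚ (K i.1) ℂ) →
      starRingEnd ℂ x = x)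
    {N : ℕ} (π : Fin N → I) : HodgeConjectureFor (⨁ fun j => A (π j)).dim (⨁ fun j => A (π j)).X :=
  hodgeConjectureFor_prod_of_foreign_blocks_of_conj_apply_eq hA b hreal
    (fun c M ρ hρ => hodgeConjectureFor_prod_block_of_simpleThreefolds_of_cubicTower hW4 hA hS h6 b is hcov h2 im τ s hs htower c M ρ hρ) π

/-- **Dominated form**: everything dominated by a product of copies of the whole family. [cite: Markman2025SurveySecant, Thm. 1.2] [cite: MumfordAV1970, §19 Thm. 1 and p. 169] -/
theorem hodgeConjectureFor_of_avDominatedBy_simpleThreefolds_blocks_of_conj_apply_eq [Finite I] [Nonempty I]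
    (hW4 : Markman2025_weilClasses_algebraic_abelianFourfold) (hA : ∀ i, IsCMTypeRealisation (Φ i) (A i) (ι i) (θ i)) (hS : ∀ i, (A i).IsSimple)
    (h6 : ∀ i, Module.finrank ℚ (K i) = 6) (b : I → β) (is : ∀ c, Fin (r c) → I) (hcov : ∀ c i, b i = c → ∃ m : Fin (r c), is c m = i)
    (h2 : ∀ c, Module.finrank ℚ (kq c) = 2) (im : ∀ c m, kq c →+* K (is c m)) (τ : ∀ c, kq c →+* ℂ) (s : ∀ c m, K (is c m) →+* ℂ)
    (hs : ∀ c m, (s c m).comp (im c m) = τ c)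
    (htower : ∀ c (m : Fin (r c)) (φ : K (is c m) →+* ℂ), φ.comp (im c m) = τ c →
      ¬ Set.range φ ⊆ (↑(adjoin ℚ (Set.range (τ c)) ⊔ adjoin ℚ (⋃ j : {j : Fin (r c) // j < m}, Set.range (s c j.1))) : Set ℂ))
    (hreal : ∀ (c : β) (x : ℂ), x ∈ (⨆ i : {i : I // b i = c}, normalClosure ℚ (K i.1) ℂ) → x ∈ (⨆ i : {i : I // b i ≠ c}, normalClosure ℚ (K i.1) ℂ) →
      starRingEnd ℂ x = x)
    {N : ℕ} (π : Fin N → I) {X : AbelianVariety ℂ} (hX : Domination.AVDominatedBy X (⨁ fun j => A (π j))) : HodgeConjectureFor X.dim X.X :=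
  Domination.hodgeConjectureFor_of_avDominatedBy
    (hodgeConjectureFor_prod_of_simpleThreefolds_blocks_of_conj_apply_eq hW4 hA hS h6 b is hcov h2 im τ s hs htower hreal π) hX

/-- **Blocks whose closure-composita meet in `ℚ`** (pairwise — indeed jointly — linearly disjoint blocks): the Hodge conjecture for every product of copies of simple CM
threefolds in foreign cubic-tower blocks, GIVEN ONLY Markman's fourfold theorem. [cite: Markman2025SurveySecant, Thm. 1.2] [cite: Lang2002, VI §1 Thm. 1.14] -/
theorem hodgeConjectureFor_prod_of_simpleThreefolds_blocks_of_inf_eq_bot [Finite I] [Nonempty I]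
    (hW4 : Markman2025_weilClasses_algebraic_abelianFourfold) (hA : ∀ i, IsCMTypeRealisation (Φ i) (A i) (ι i) (θ i)) (hS : ∀ i, (A i).IsSimple)
    (h6 : ∀ i, Module.finrank ℚ (K i) = 6) (b : I → β) (is : ∀ c, Fin (r c) → I) (hcov : ∀ c i, b i = c → ∃ m : Fin (r c), is c m = i)
    (h2 : ∀ c, Module.finrank ℚ (kq c) = 2) (im : ∀ c m, kq c →+* K (is c m)) (τ : ∀ c, kq c →+* ℂ) (s : ∀ c m, K (is c m) →+* ℂ)
    (hs : ∀ c m, (s c m).comp (im c m) = τ c)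
    (htower : ∀ c (m : Fin (r c)) (φ : K (is c m) →+* ℂ), φ.comp (im c m) = τ c →
      ¬ Set.range φ ⊆ (↑(adjoin ℚ (Set.range (τ c)) ⊔ adjoin ℚ (⋃ j : {j : Fin (r c) // j < m}, Set.range (s c j.1))) : Set ℂ))
    (hinf : ∀ c : β, (⨆ i : {i : I // b i = c}, normalClosure ℚ (K i.1) ℂ) ⊓ (⨆ i : {i : I // b i ≠ c}, normalClosure ℚ (K i.1) ℂ) = ⊥)
    {N : ℕ} (π : Fin N → I) : HodgeConjectureFor (⨁ fun j => A (π j)).dim (⨁ fun j => A (π j)).X :=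
  hodgeConjectureFor_prod_of_foreign_blocks_of_inf_eq_bot hA b hinf
    (fun c M ρ hρ => hodgeConjectureFor_prod_block_of_simpleThreefolds_of_cubicTower hW4 hA hS h6 b is hcov h2 im τ s hs htower c M ρ hρ) π

/-- **Blocks whose closure-composita meet in fields of ODD degree** (a normal subfield of `ℂ` of odd degree is totally real). [cite: Markman2025SurveySecant, Thm. 1.2]
[cite: Lang2002, VI §1 Thm. 1.14] -/
theorem hodgeConjectureFor_prod_of_simpleThreefolds_blocks_of_odd_finrank_inf [Finite I] [Nonempty I]
    (hW4 : Markman2025_weilClasses_algebraic_abelianFourfold) (hA : ∀ i, IsCMTypeRealisation (Φ i) (A i) (ι i) (θ i)) (hS : ∀ i, (A i).IsSimple)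
    (h6 : ∀ i, Module.finrank ℚ (K i) = 6) (b : I → β) (is : ∀ c, Fin (r c) → I) (hcov : ∀ c i, b i = c → ∃ m : Fin (r c), is c m = i)
    (h2 : ∀ c, Module.finrank ℚ (kq c) = 2) (im : ∀ c m, kq c →+* K (is c m)) (τ : ∀ c, kq c →+* ℂ) (s : ∀ c m, K (is c m) →+* ℂ)
    (hs : ∀ c m, (s c m).comp (im c m) = τ c)
    (htower : ∀ c (m : Fin (r c)) (φ : K (is c m) →+* ℂ), φ.comp (im c m) = τ c →
      ¬ Set.range φ ⊆ (↑(adjoin ℚ (Set.range (τ c)) ⊔ adjoin ℚ (⋃ j : {j : Fin (r c) // j < m}, Set.range (s c j.1))) : Set ℂ))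
    (hodd : ∀ c : β, Odd (Module.finrank ℚ
      ↥((⨆ i : {i : I // b i = c}, normalClosure ℚ (K i.1) ℂ) ⊓ (⨆ i : {i : I // b i ≠ c}, normalClosure ℚ (K i.1) ℂ))))
    {N : ℕ} (π : Fin N → I) : HodgeConjectureFor (⨁ fun j => A (π j)).dim (⨁ fun j => A (π j)).X :=
  hodgeConjectureFor_prod_of_foreign_blocks_of_odd_finrank_inf hA b hodd
    (fun c M ρ hρ => hodgeConjectureFor_prod_block_of_simpleThreefolds_of_cubicTower hW4 hA hS h6 b is hcov h2 im τ s hs htower c M ρ hρ) π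

end Blocks

end Summit.HodgeConjecture.CorCM.MultiFieldWeil

end
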